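import Summits.CriticalPhenomena.PercolationContinuityZ3.Theorems.PercNearOneGluingNoHeavyLowerTailQuantitativeCovDUpperComparable
import HarnessLib

/-!
# The upper half of BENCH row M2-R50 on the MIRROR comparable family (row M2-R51 (b)):
# `f = M` on `{x↔u}`, `f = g ≤ M` off it — `covD(f; u) ≤ μ(D) · Cov_{w_Y}(f(𝒞_x), 1{x↔u})`, no monotonicity needed

Support file (`--supports stmt-CriticalPhenomena-4575`), prover seat `prim-rate-mine-2` (lane prim-rate, constants-miner (c), BENCH row
M2-R51 (b); `run/shared/lean/prim/prim-rate/prim-rate-mine-2/PROOFS.md` §P51 (b)).  No definitions, no named facts, no sorries; standard axioms.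

Companion of `…QuantitativeCovDUpperComparable` (`CSH.covD_mul_conn_le_isolated`: the upper half of the M2-R50 sandwich for `f = g·χ_u`,
i.e. `f` constant on `{u ∉ V(𝒞_x)}`).  Here `f` is constant ON `{u ∈ V(𝒞_x)}`: `f = g + (M − g)·χ_u` (`= M` on `A = {x↔u}`, `= g` off `A`) with
`g ≤ M` — and NO monotonicity of `g` is needed:
* **`CSH.covD_constOnConn_le_isolated`** — ANY weights in `[0,1]`, any `Y`, `x`, `u`, any `g ≤ M`:
  `covD w x Y (g + (M−g)·χ_u) u ≤ μ(D) · (∫_{x↔u} f(𝒞_x) dμ_{w_Y} − (∫ f(𝒞_x) dμ_{w_Y}) · μ_{w_Y}(x↔u))`, `f = g + (M−g)·χ_u`, `D = {x ↮ Y}`,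
  `w_Y` = `w` zeroed on the pairs `E_Y` meeting `Y`.
Proof (PROOFS §P51 (b)).  `covD(f) = μ(D∩A) · ∫_{D∖A} (M − g)(𝒞_x) dμ` and the bracket is `μ_{w_Y}(A) · ∫_{Aᶜ} (M − g)(𝒞_x) dμ_{w_Y}`.  With
`A^Y = {ω : ω ∖ E_Y ∈ A}` (increasing, `μ(A^Y) = μ_{w_Y}(A)` by the deletion identity `BHK2006.integral_comp_sdiff_prodBernoulli'`): on `D` the cluster of
`x` does not see `E_Y` (`CSH.openEdgeCluster_sdiff_pairsAt_eq`), so `D ∩ A = D ∩ A^Y` and Harris for the up-sets `A^Y`, `Dᶜ`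
(`QuantHarris.real_mul_real_le_real_inter`) gives `μ(D∩A) ≤ μ(D)·μ_{w_Y}(A)`; and pointwise `1_{D∖A}(ω)·(M−g)(𝒞_x(ω)) ≤ 1_{Aᶜ}(ω∖E_Y)·(M−g)(𝒞_x(ω∖E_Y))`
gives `∫_{D∖A}(M−g) dμ ≤ ∫_{Aᶜ}(M−g) dμ_{w_Y}`.  Together with l.172/l.174 (general `f`: FALSE) and the companion file: the upper half of M2-R50 holds
exactly as far as `f` is constant on one side of `{u ∈ V(𝒞_x)}`.
[cite: Harris1960, Lemma 4.1 (p. 16)] [cite: VandenbergHaggstromKahn2005, Thm. 1.3 (p. 6), §2.1 Lemma 2.3 (p. 10)]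
-/

noncomputable section

namespace Summit.CriticalPhenomena.PercolationContinuityZ3.Theorems.CSH

open MeasureTheory Set unitInterval
open Literature.Probability.LatticeModels (prodBernoulli)
open Literature.Probability.Percolation
open Literature.Probability.Percolation.BHK2006 (openEdgeCluster_mono)
open scoped Classical

variable {V : Type*} [Fintype V]

/-- **Row M2-R51 (b) — the upper half of the M2-R50 sandwich for `f` constant on `{u ∈ V(𝒞_x)}`.**  ANY weights in `[0,1]`, any `Y`, `x`, `u`,
any `g : Set (Sym2 V) → ℝ` with `g ≤ M` (no monotonicity needed); `f := g + (M − g)·χ_u`, `w_Y` = `w` zeroed on the pairs meeting `Y`, `D = {x ↮ Y}`: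
`covD w x Y f u ≤ μ(D) · (∫_{x↔u} f(𝒞_x) dμ_{w_Y} − (∫ f(𝒞_x) dμ_{w_Y}) · μ_{w_Y}(x↔u))`.
[cite: Harris1960, Lemma 4.1 (p. 16)] [cite: VandenbergHaggstromKahn2005, Thm. 1.3 (p. 6), §2.1 Lemma 2.3 (p. 10)] -/
theorem covD_constOnConn_le_isolated (w : Sym2 V → unitInterval) (x : V) (Y : Set V) (u : V)
    (g : Set (Sym2 V) → ℝ) (M : ℝ) (hgM : ∀ C, g C ≤ M) :
    covD w x Y (fun C => g C + (M - g C) * connIndicatorFn x u C) u ≤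
      (prodBernoulli w).real {ω : BondConfig V | ∀ y ∈ Y, ¬ (openGraph ω).Reachable x y} *
        ((∫ η in openConn x u, (g (openEdgeCluster η x) + (M - g (openEdgeCluster η x)) * connIndicatorFn x u (openEdgeCluster η x))
            ∂(prodBernoulli fun e => if (∃ y ∈ Y, y ∈ e) then (0 : unitInterval) else w e)) -
          (∫ η, (g (openEdgeCluster η x) + (M - g (openEdgeCluster η x)) * connIndicatorFn x u (openEdgeCluster η x))
              ∂(prodBernoulli fun e => if (∃ y ∈ Y, y ∈ e) then (0 : unitInterval) else w e)) *
            (prodBernoulli fun e => if (∃ y ∈ Y, y ∈ e) then (0 : unitInterval) else w e).real (openConn x u)) := by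
  set μ := prodBernoulli w with hμ
  set D : Set (BondConfig V) := {ω | ∀ y ∈ Y, ¬ (openGraph ω).Reachable x y} with hD
  set A : Set (BondConfig V) := openConn x u with hA
  set E : Set (Sym2 V) := {e | ∃ y ∈ Y, y ∈ e} with hE
  set wY : Sym2 V → unitInterval := fun e => if (∃ y ∈ Y, y ∈ e) then (0 : unitInterval) else w e with hwY
  set ν := prodBernoulli wY with hν
  -- the integrand `F = f(𝒞_x)` and the deficit `G = M − g(𝒞_x) ≥ 0`
  set F : BondConfig V → ℝ := fun ω =>
    g (openEdgeCluster ω x) + (M - g (openEdgeCluster ω x)) * connIndicatorFn x u (openEdgeCluster ω x) with hF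
  set G : BondConfig V → ℝ := fun ω => M - g (openEdgeCluster ω x) with hG
  set AY : Set (BondConfig V) := {ω | ω \ E ∈ A} with hAY
  have hmeas : ∀ S : Set (BondConfig V), MeasurableSet S := fun _ => MeasurableSet.of_discrete
  have hE0 : ∀ e ∈ E, wY e = 0 := fun e he => by simp only [hwY]; exact if_pos he
  have hE1 : ∀ e ∉ E, wY e = w e := fun e he => by simp only [hwY]; exact if_neg he
  have hG0 : ∀ ω, 0 ≤ G ω := fun ω => sub_nonneg.2 (hgM _)
  -- `F = M` on `A`, `F = M − G` off `A`
  have hFA : ∀ ω, F ω = g (openEdgeCluster ω x) + (M - g (openEdgeCluster ω x)) * A.indicator 1 ω := fun ω => by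
    simp only [hF, hA, connIndicatorFn_openEdgeCluster]
  have hFon : ∀ ω ∈ A, F ω = M := fun ω hω => by rw [hFA, Set.indicator_of_mem hω, Pi.one_apply]; ring
  have hFoff : ∀ ω ∉ A, F ω = M - G ω := fun ω hω => by rw [hFA, Set.indicator_of_notMem hω]; simp only [hG]; ring
  -- on `D`: the cluster does not see `E`, so `A ↔ AY` and `G = G ∘ (· \ E)`
  have hclD : ∀ ω ∈ D, openEdgeCluster (ω \ E) x = openEdgeCluster ω x := fun ω hω => openEdgeCluster_sdiff_pairsAt_eq hω
  have hAiff : ∀ ω ∈ D, (ω ∈ A ↔ ω ∈ AY) := fun ω hω => by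
    have h1 : A.indicator (1 : BondConfig V → ℝ) ω = A.indicator 1 (ω \ E) := by
      rw [← connIndicatorFn_openEdgeCluster, ← connIndicatorFn_openEdgeCluster, hclD ω hω]
    change ω ∈ A ↔ ω \ E ∈ A
    by_cases ha : ω ∈ A <;> by_cases hb : ω \ E ∈ A
    · exact ⟨fun _ => hb, fun _ => ha⟩
    · rw [Set.indicator_of_mem ha, Set.indicator_of_notMem hb, Pi.one_apply] at h1; exact absurd h1 one_ne_zero
    · rw [Set.indicator_of_notMem ha, Set.indicator_of_mem hb, Pi.one_apply] at h1; exact absurd h1.symm one_ne_zero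
    · exact ⟨fun h => absurd h ha, fun h => absurd h hb⟩
  -- Step 0: product forms of the two sides
  set K : ℝ := ∫ ω in D \ A, G ω ∂μ with hKdef
  set L : ℝ := ∫ η in Aᶜ, G η ∂ν with hLdef
  have hIA : ∫ ω in D ∩ A, F ω ∂μ = M * μ.real (D ∩ A) := by
    rw [setIntegral_congr_fun (hmeas _) (fun ω hω => hFon ω hω.2), setIntegral_const, smul_eq_mul, mul_comm]
  have hID : ∫ ω in D, F ω ∂μ = M * μ.real (D ∩ A) + (M * μ.real (D \ A) - K) := by
    rw [← integral_inter_add_sdiff (hmeas A) (Integrable.of_finite).integrableOn, hIA]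
    congr 1
    rw [setIntegral_congr_fun (hmeas _) (fun ω hω => hFoff ω hω.2), integral_sub (Integrable.of_finite) (Integrable.of_finite),
      setIntegral_const, smul_eq_mul, mul_comm]
  have hcov : covD w x Y (fun C => g C + (M - g C) * connIndicatorFn x u C) u =
      μ.real D * (∫ ω in D ∩ A, F ω ∂μ) - (∫ ω in D, F ω ∂μ) * μ.real (D ∩ A) := rfl
  have hDsplit : μ.real (D ∩ A) + μ.real (D \ A) = μ.real D := measureReal_inter_add_sdiff (hmeas A)
  have hcov' : covD w x Y (fun C => g C + (M - g C) * connIndicatorFn x u C) u = μ.real (D ∩ A) * K := by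
    rw [hcov, hIA, hID, ← hDsplit]; ring
  have hJA : ∫ η in A, F η ∂ν = M * ν.real A := by
    rw [setIntegral_congr_fun (hmeas _) (fun η hη => hFon η hη), setIntegral_const, smul_eq_mul, mul_comm]
  have hJ : ∫ η, F η ∂ν = M * ν.real A + (M * ν.real Aᶜ - L) := by
    rw [← integral_add_compl (hmeas A) (Integrable.of_finite), hJA]
    congr 1
    rw [setIntegral_congr_fun (hmeas Aᶜ) (fun η (hη : η ∈ Aᶜ) => hFoff η hη), integral_sub (Integrable.of_finite) (Integrable.of_finite),
      setIntegral_const, smul_eq_mul, mul_comm]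
  have hνsplit : ν.real A + ν.real Aᶜ = 1 := by
    rw [← probReal_univ (μ := ν), ← Set.union_compl_self A]
    exact (measureReal_union disjoint_compl_right (hmeas Aᶜ)).symm
  have hrhs : (∫ η in A, F η ∂ν) - (∫ η, F η ∂ν) * ν.real A = ν.real A * L := by
    rw [hJA, hJ]
    have : ν.real Aᶜ = 1 - ν.real A := by linarith
    rw [this]; ring
  -- Step 1 (Harris for events): `μ(D ∩ A) ≤ μ(D) · μ_{w_Y}(A)`
  have hAY_up : ∀ ω ω' : BondConfig V, ω ⊆ ω' → ω ∈ AY → ω' ∈ AY := fun ω ω' h hω =>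
    isUpperSet_openConn x u (Set.sdiff_subset_sdiff_left h) hω
  have hDc_up : ∀ ω ω' : BondConfig V, ω ⊆ ω' → ω ∈ Dᶜ → ω' ∈ Dᶜ := fun ω ω' hle h => by
    simp only [hD, Set.mem_compl_iff, Set.mem_setOf_eq, not_forall, not_not] at h ⊢
    obtain ⟨y, hy, hr⟩ := h
    exact ⟨y, hy, hr.mono (openGraph_mono hle)⟩
  have hAYν : μ.real AY = ν.real A := by
    rw [← integral_indicator_one (hmeas _), ← integral_indicator_one (hmeas A),
      ← BHK2006.integral_comp_sdiff_prodBernoulli' w wY E hE0 hE1 (A.indicator 1)]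
    refine integral_congr_ae (Filter.Eventually.of_forall fun ω => ?_)
    by_cases hω : ω \ E ∈ A
    · have h1 : ω ∈ AY := hω
      simp only [Set.indicator_of_mem h1, Set.indicator_of_mem hω, Pi.one_apply]
    · have h1 : ω ∉ AY := hω
      simp only [Set.indicator_of_notMem h1, Set.indicator_of_notMem hω]
  have hDA_le : μ.real (D ∩ A) ≤ μ.real D * ν.real A := by
    have hDAY : D ∩ A = AY \ Dᶜ := by
      ext ω
      simp only [Set.mem_inter_iff, Set.mem_sdiff, Set.mem_compl_iff, not_not]
      constructor
      · rintro ⟨hd, ha⟩; exact ⟨(hAiff ω hd).1 ha, hd⟩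
      · rintro ⟨hay, hd⟩; exact ⟨hd, (hAiff ω hd).2 hay⟩
    have hH := QuantHarris.real_mul_real_le_real_inter w AY Dᶜ hAY_up hDc_up
    have hsplit : μ.real (AY ∩ Dᶜ) + μ.real (AY \ Dᶜ) = μ.real AY := measureReal_inter_add_sdiff (hmeas Dᶜ)
    have hDc : μ.real Dᶜ = 1 - μ.real D := by
      have h1 : μ.real D + μ.real Dᶜ = 1 := by
        rw [← probReal_univ (μ := μ), ← Set.union_compl_self D]
        exact (measureReal_union disjoint_compl_right (hmeas Dᶜ)).symm
      linarith
    rw [hDAY, ← hAYν]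
    rw [← hμ] at hH
    rw [hDc] at hH
    nlinarith [hH, hsplit, measureReal_nonneg (μ := μ) (s := AY), measureReal_nonneg (μ := μ) (s := D)]
  -- Step 2 (pointwise): `K ≤ L`
  have hK_le : K ≤ L := by
    have hK : K = ∫ ω, (D \ A).indicator G ω ∂μ := (integral_indicator (hmeas _)).symm
    have hL : L = ∫ ω, (fun η => Aᶜ.indicator G (η \ E)) ω ∂μ := by
      rw [BHK2006.integral_comp_sdiff_prodBernoulli' w wY E hE0 hE1 (Aᶜ.indicator G), integral_indicator (hmeas _)]
    rw [hK, hL]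
    refine integral_mono (Integrable.of_finite) (Integrable.of_finite) fun ω => ?_
    by_cases hω : ω ∈ D \ A
    · have hGY : G ω = G (ω \ E) := by simp only [hG, hclD ω hω.1]
      have hω' : ω \ E ∈ Aᶜ := fun h => hω.2 ((hAiff ω hω.1).2 h)
      show (D \ A).indicator G ω ≤ Aᶜ.indicator G (ω \ E)
      rw [Set.indicator_of_mem hω, Set.indicator_of_mem hω', hGY]
    · show (D \ A).indicator G ω ≤ Aᶜ.indicator G (ω \ E)
      rw [Set.indicator_of_notMem hω]
      exact Set.indicator_nonneg (fun η _ => hG0 η) _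
  -- Step 3: multiply
  have hK0 : 0 ≤ K := setIntegral_nonneg (hmeas _) fun ω _ => hG0 ω
  rw [hcov', hrhs]
  calc μ.real (D ∩ A) * K ≤ (μ.real D * ν.real A) * L :=
        mul_le_mul hDA_le hK_le hK0 (mul_nonneg measureReal_nonneg measureReal_nonneg)
    _ = μ.real D * (ν.real A * L) := by ring

end Summit.CriticalPhenomena.PercolationContinuityZ3.Theorems.CSH

end
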